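import Summits.QuantumFields.YangMills.Theorems.BalabanStepParabolic.Negative.FaceContactSetup
import Summits.QuantumFields.YangMills.Theorems.ParabolicTrajectoryBalabanStepParabolicRegulatorChartBridge
import HarnessLib

/-!
# `BalabanStepParabolic` — negative-side support: PERIODIC FACE CONTACT
# (`¬ BalabanStepParabolic` modulo plaquette-covariance positivity and a nearest-neighbour lower bound)

Support file for crux `stmt-QuantumFields-9684` (`ParabolicTrajectory.BalabanStepParabolic`), standing disprover
(cdisprove gen 4, cycle 4). Tree objects only.

## The finding

Field (4c) of `BalabanBanachStep` asks continuity of `p ↦ expect p S n σ f` for every tuple `f` of real test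
functions whose tensor product is OFF-DIAGONAL IN `ℝ⁴ⁿ` (`IsOffDiagonal (tensorFin n …)`), while by (4a)+(4b) the
values of `expect` at the depth-`k` orbit points of Wilson points are the centred Wilson `n`-point functions on the
PERIODIC torus of side `M^k (2L+1)` with the `k`-fold block-dilated test functions sampled on the fundamental domain
`box 4 L_k` (`wilsonCentredSchwinger`, `smearedLatticeField`, `torusLift`).  Two bumps `f⁻`, `f⁺` centred at the
two face points `(∓ 1/2, 0, 0, 0)` of the unit fundamental domain (base torus `2·0+1 = 1`) have DISJOINT supports in
`ℝ⁴` — the pair is off-diagonal — but their periodisations TOUCH across the glued face: the dilated samples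
`f⁻(x/M^k)`, `f⁺(y/M^k)` equal `1` on the two opposite faces `x₀ = -L_k`, `y₀ = +L_k` of `box 4 L_k`, which are
NEAREST NEIGHBOURS on the torus.  The smeared centred two-point function of the curvature species therefore contains
`≥ (M^k/16)³` torus-nearest-neighbour plaquette covariances with weight `1` (`faceData_lower_bound`).

* `overtuned_trivial_of_nonempty` (`Negative/OverTunedLimit`, drefute gen 2): EVERY inhabitant of
  `BalabanBanachStep G r M`, `M` odd, forces these data to tend to `0` along every sequence `β_i ≥ β₀`, `k_i → ∞`,
  `k_i ≤ A β_i`.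
* Under the two hypotheses below on the torus Wilson theory of `(G, r)` at large `β` — (H₁) `PlaquetteCovNonneg`:
  the covariances of the action densities at any two sites are `≥ 0` (a Griffiths/GKS-II-type inequality; known for
  abelian models, OPEN for non-abelian lattice gauge theory), (H₂) `AdjacentCovLowerBound`: the covariance of the
  action densities at nearest-neighbour sites is `≥ c β^{-p}` uniformly in the volume (its leading perturbative size
  is `const·β⁻²`; a proof at weak coupling in `d = 4` would require the complete small-field/large-field control of
  Bałaban's programme, OPEN) — the same data are `≥ (M^{k}/16)³ c β^{-p} → ∞` along `β_i = max B (k_i/A)`: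
  contradiction.  Hence `not_nonempty_of_faceContact`: NO inhabitant at odd `M`, and
  `balabanStepParabolic_false_of_faceContactHypothesis : FaceContactHypothesis → ¬ BalabanStepParabolic`
  (`FaceContactHypothesis` = H₁ ∧ H₂ for `SU(2)` with Wilson's fundamental action; `SU(2)` is a certified compact
  simple Lie group in the tree).

## Classification (for the planner): refuted-MISSTATED modulo H

The witness exploits a side condition the author plainly did not intend: (4c) excludes coincident points in `ℝ⁴ⁿ`
("at coinciding points contact terms diverge and continuity would be false for every instance", module docstring of
`BalabanBanachStep`) but not coincidences created by the periodic identification of opposite faces of the sampling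
box.  Minimal repair `C′`: in (4c) quantify only over tuples with `∀ i, tsupport (f i) ⊆ {u | ∀ j, |u j| < S/2}`
(supports compactly inside the OPEN fundamental cube of the torus of side `S`; the condition is dilation-compatible,
`tsupport (blockDilate M f) = M • tsupport f ⊆` open cube of side `M S`, and makes the periodised tuple off-diagonal).
The witness `(f⁻, f⁺)` misses `C′`.  The same clause, verbatim, sits in `RegulatorChart` (field at
`Literature/…/BalabanRegulatorChart.lean:173`), the object of the picked line `perfect-action-regulator-chart`.
-/

namespace Summit.QuantumFields.YangMills.Theorems.BalabanStepParabolic.Negative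

open scoped SchwartzMap
open MeasureTheory Filter Topology
open Literature.MathematicalPhysics.QuantumFieldTheory Literature.MathematicalPhysics.AQFT
open Literature.MathematicalPhysics.QuantumLattice
open Literature.Probability.LatticeModels (box mem_box card_box Torus.proj Torus.proj_apply)

noncomputable section

/-! ### The lower bound and the contradiction -/

section Contradiction

variable {G : Type} [Group G] [TopologicalSpace G] [IsTopologicalGroup G] [CompactSpace G]
  [MeasurableSpace G] [BorelSpace G] (r : LatticeRep G) {M : ℕ}

/-- **Face-contact lower bound.** Under (H₁), (H₂) at `β`, on the torus `T = M^k = 2L_k+1 ≥ 16` (odd `M`) the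
centred curvature two-point function of the `k`-fold dilated face pair is at least
`(2⌊T/16⌋+1)³ · c β^{-p}`: the double sum of `wilsonCentredSchwinger_two_eq` has non-negative terms, and the
`(2⌊T/16⌋+1)³` torus-nearest-neighbour face pairs `((-L_k, x'), (L_k, x'))` carry weight `1 · 1` and covariance
`≥ c β^{-p}`. [folklore] -/
theorem faceData_lower_bound (hM : Odd M) (hM0 : M ≠ 0)
    {β₁ : ℝ} {L₁ : ℕ} (h₁ : ∀ β : ℝ, β₁ ≤ β → ∀ L : ℕ, L₁ ≤ L → ∀ x y : Fin 4 → ℤ, 0 ≤ siteCov r β L x y)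
    {c : ℝ} {p : ℕ} {β₂ : ℝ} {L₂ : ℕ}
    (h₂ : ∀ β : ℝ, β₂ ≤ β → ∀ L : ℕ, L₂ ≤ L → ∀ x : Fin 4 → ℤ, c / β ^ p ≤ siteCov r β L x (x + Pi.single 0 1))
    {k : ℕ} (hk16 : 16 ≤ M ^ k) (hkL : 2 * max L₁ L₂ + 1 ≤ M ^ k) {β : ℝ} (hβ₁ : β₁ ≤ β) (hβ₂ : β₂ ≤ β) :
    ((2 * (M ^ k / 16) + 1 : ℕ) : ℝ) ^ 3 * (c / β ^ p) ≤
      wilsonCentredSchwinger r.ρ β ((M ^ k - 1) / 2) (fun _ => 1) 2 (fun _ => r.curvature)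
        (fun j => (blockDilate M)^[k] (facePair j)) := by
  -- the torus `T = M^k = 2 Lk + 1`
  obtain ⟨Lk, h2Lk⟩ : ∃ Lk, 2 * Lk + 1 = M ^ k := by
    have h := pow_mul_odd_eq hM k 0
    exact ⟨_, by simpa using h.symm⟩
  have hLkdef : (M ^ k - 1) / 2 = Lk := by omega
  rw [hLkdef]
  have hL₁ : L₁ ≤ Lk := by omega
  have hL₂ : L₂ ≤ Lk := by omega
  generalize hmdef : M ^ k / 16 = m
  have hmT : m ≤ M ^ k / 16 := hmdef.ge
  have hmLk : m ≤ Lk := by omega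
  have hTcast : ((M : ℝ) ^ k)⁻¹ = (((M ^ k : ℕ) : ℝ))⁻¹ := by rw [Nat.cast_pow]
  -- expand
  rw [wilsonCentredSchwinger_two_eq]
  simp only [facePair, Matrix.cons_val_zero, Matrix.cons_val_one, blockDilate_iterate_apply hM0, hTcast]
  -- the face-pair injection and the summand over pairs (opaque names with defining equations)
  obtain ⟨e, he⟩ : ∃ e : (Fin 3 → ℤ) → (Fin 4 → ℤ) × (Fin 4 → ℤ),
      e = fun x' => (faceSite (-(Lk : ℤ)) x', faceSite (Lk : ℤ) x') := ⟨_, rfl⟩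
  have einj : Function.Injective e := by
    intro x y h
    rw [he] at h
    exact faceSite_injective _ (congrArg Prod.snd h)
  obtain ⟨Ψ, hΨ⟩ : ∃ Ψ : (Fin 4 → ℤ) × (Fin 4 → ℤ) → ℝ, Ψ = fun q =>
      faceTest (-(1 / 2)) ((((M ^ k : ℕ) : ℝ))⁻¹ • siteToE q.1) *
        faceTest (1 / 2) ((((M ^ k : ℕ) : ℝ))⁻¹ • siteToE q.2) * siteCov r β Lk q.1 q.2 := ⟨_, rfl⟩
  have hΨnn : ∀ q, 0 ≤ Ψ q := fun q => by
    rw [hΨ]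
    exact mul_nonneg (mul_nonneg (faceTest_nonneg _ _) (faceTest_nonneg _ _)) (h₁ β hβ₁ Lk hL₁ q.1 q.2)
  have hsub : (box 3 m).map ⟨e, einj⟩ ⊆ box 4 Lk ×ˢ box 4 Lk := by
    intro q hq
    rw [Finset.mem_map] at hq
    obtain ⟨x', hx', rfl⟩ := hq
    rw [mem_box] at hx'
    have hx'' : ∀ i, -(Lk : ℤ) ≤ x' i ∧ x' i ≤ Lk := fun i => by
      have := hx' i; constructor <;> omega
    have hLk0 : -(Lk : ℤ) ≤ Lk ∧ (Lk : ℤ) ≤ Lk := by constructor <;> omega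
    have hLk1 : -(Lk : ℤ) ≤ -Lk ∧ -(Lk : ℤ) ≤ Lk := by constructor <;> omega
    show e x' ∈ box 4 Lk ×ˢ box 4 Lk
    rw [he]
    exact Finset.mem_product.2 ⟨faceSite_mem_box hLk1 hx'', faceSite_mem_box hLk0 hx''⟩
  -- each face pair contributes at least c / β^p
  have hterm : ∀ x' ∈ box 3 m, c / β ^ p ≤ Ψ (e x') := by
    intro x' hx'
    rw [mem_box] at hx'
    have hplatm : faceTest (-(1 / 2)) ((((M ^ k : ℕ) : ℝ))⁻¹ • siteToE (faceSite (-(Lk : ℤ)) x')) = 1 :=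
      faceTest_eq_one _ (dist_sample_le hk16 (face_coord_neg h2Lk hk16) hmT hx')
    have hplatp : faceTest (1 / 2) ((((M ^ k : ℕ) : ℝ))⁻¹ • siteToE (faceSite (Lk : ℤ) x')) = 1 :=
      faceTest_eq_one _ (dist_sample_le hk16 (face_coord_pos h2Lk hk16) hmT hx')
    have hcov : c / β ^ p ≤ siteCov r β Lk (faceSite (-(Lk : ℤ)) x') (faceSite (Lk : ℤ) x') := by
      rw [siteCov_comm, siteCov_congr_right r β Lk (faceSite (Lk : ℤ) x')
        (y' := faceSite (Lk : ℤ) x' + Pi.single 0 1) ?_]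
      · exact h₂ β hβ₂ Lk hL₂ _
      · rw [faceSite_add_single, proj_add_period]
    rw [hΨ, he]
    simp only [hplatm, hplatp, one_mul]
    exact hcov
  -- assemble
  calc ((2 * m + 1 : ℕ) : ℝ) ^ 3 * (c / β ^ p)
      = ∑ _x' ∈ box 3 m, c / β ^ p := by
        rw [Finset.sum_const, nsmul_eq_mul, card_box]; push_cast; ring
    _ ≤ ∑ x' ∈ box 3 m, Ψ (e x') := Finset.sum_le_sum hterm
    _ = ∑ q ∈ (box 3 m).map ⟨e, einj⟩, Ψ q := (Finset.sum_map (box 3 m) ⟨e, einj⟩ Ψ).symm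
    _ ≤ ∑ q ∈ box 4 Lk ×ˢ box 4 Lk, Ψ q :=
        Finset.sum_le_sum_of_subset_of_nonneg hsub fun q _ _ => hΨnn q
    _ = ∑ x ∈ box 4 Lk, ∑ y ∈ box 4 Lk, Ψ (x, y) := Finset.sum_product (box 4 Lk) (box 4 Lk) Ψ
    _ = _ := by simp only [hΨ]

/-- **No inhabitant at odd block factors under (H₁), (H₂).** Every inhabitant of `BalabanBanachStep G r M`, `M`
odd, forces the centred curvature two-point functions of ALL `ℝ⁸`-off-diagonal pairs — in particular of the
face-touching pair — to tend to `0` along `β_i = max B (i/A)`, `k_i = i` (`overtuned_trivial_of_nonempty`), while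
by `faceData_lower_bound` they are `≥ (M^i/16)³ c A^p i^{-p} → ∞`. [folklore] -/
theorem not_nonempty_of_faceContact (h₁ : PlaquetteCovNonneg r) (h₂ : AdjacentCovLowerBound r)
    (hM : Odd M) : ¬ Nonempty (BalabanBanachStep G r M) := by
  intro hS
  obtain ⟨S⟩ := hS
  have hM2 : 2 ≤ M := S.two_le_M
  have hM0 : M ≠ 0 := by omega
  have hM1 : 1 < M := by omega
  obtain ⟨β₁, L₁, h₁⟩ := h₁
  obtain ⟨c, hc, p, β₂, L₂, h₂⟩ := h₂
  obtain ⟨β₀, A, hA, hlim⟩ := overtuned_trivial_of_nonempty hM ⟨S⟩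
  -- the over-tuned sequence
  set B : ℝ := max (max β₀ β₁) (max β₂ 1) with hB
  set β : ℕ → ℝ := fun i => max B ((i : ℝ) / A) with hβ
  have hβB : ∀ i, B ≤ β i := fun i => le_max_left _ _
  have hβ₀ : ∀ i, β₀ ≤ β i := fun i =>
    ((le_max_left _ _).trans (le_max_left _ _)).trans (hβB i)
  have hβ₁ : ∀ i, β₁ ≤ β i := fun i =>
    ((le_max_right _ _).trans (le_max_left _ _)).trans (hβB i)
  have hβ₂ : ∀ i, β₂ ≤ β i := fun i =>
    ((le_max_left _ _).trans (le_max_right _ _)).trans (hβB i)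
  have hkA : ∀ i, ((i : ℕ) : ℝ) ≤ A * β i := fun i => by
    have h : (i : ℝ) / A ≤ β i := le_max_right _ _
    rwa [div_le_iff₀ hA, mul_comm] at h
  have hW := hlim β (fun i => i) hβ₀ tendsto_id hkA 0 1 facePair isOffDiagonal_facePair
  have hW' : Tendsto (fun i => wilsonCentredSchwinger r.ρ (β i) ((M ^ i - 1) / 2) (fun _ => 1) 2
      (fun _ => r.curvature) (fun j => (blockDilate M)^[i] (facePair j))) atTop (𝓝 0) := by
    simpa only [Nat.mul_zero, Nat.zero_add, Nat.mul_one] using hW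
  -- eventually the data are ≥ 1
  have hpow : Tendsto (fun n : ℕ => M ^ n) atTop atTop := tendsto_pow_atTop_atTop_of_one_lt hM1
  have hM3 : (1 : ℝ) < (M : ℝ) ^ 3 := by
    have : (1 : ℝ) < M := by exact_mod_cast hM1
    exact one_lt_pow₀ this (by norm_num)
  have hsmall : ∀ᶠ i : ℕ in atTop, (i : ℝ) ^ p / ((M : ℝ) ^ 3) ^ i ≤ c * A ^ p / 4096 :=
    (tendsto_pow_const_div_const_pow_of_one_lt p hM3).eventually (ge_mem_nhds (by positivity))
  have hbig : ∀ᶠ i : ℕ in atTop, B ≤ (i : ℝ) / A := by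
    have ht : Tendsto (fun i : ℕ => (i : ℝ) / A) atTop atTop :=
      tendsto_natCast_atTop_atTop.atTop_div_const hA
    exact ht.eventually_ge_atTop B
  have h16 : ∀ᶠ i : ℕ in atTop, 16 ≤ M ^ i := hpow.eventually_ge_atTop 16
  have hLL : ∀ᶠ i : ℕ in atTop, 2 * max L₁ L₂ + 1 ≤ M ^ i := hpow.eventually_ge_atTop _
  have hone : ∀ᶠ i : ℕ in atTop, (1 : ℝ) ≤ i := by
    filter_upwards [eventually_ge_atTop 1] with i hi
    exact_mod_cast hi
  have hev : ∀ᶠ i : ℕ in atTop, (1 : ℝ) ≤ wilsonCentredSchwinger r.ρ (β i) ((M ^ i - 1) / 2) (fun _ => 1) 2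
      (fun _ => r.curvature) (fun j => (blockDilate M)^[i] (facePair j)) := by
    filter_upwards [hsmall, hbig, h16, hLL, hone] with i hsm hbi h16i hLLi h1i
    have hβi : β i = (i : ℝ) / A := max_eq_right hbi
    have hlb := faceData_lower_bound r hM hM0 h₁ h₂ h16i hLLi (hβ₁ i) (hβ₂ i)
    refine le_trans ?_ hlb
    -- arithmetic: 1 ≤ (2m+1)^3 * (c / β^p)
    have hi0 : (0 : ℝ) < i := by linarith
    have hu : ((M : ℝ) ^ i) / 16 ≤ ((2 * (M ^ i / 16) + 1 : ℕ) : ℝ) := by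
      have hdiv : ((M ^ i : ℕ) : ℝ) / 16 - 1 ≤ ((M ^ i / 16 : ℕ) : ℝ) := by
        have := Nat.cast_div_le (α := ℝ) (m := M ^ i) (n := 16)
        have h' : ((M ^ i : ℕ) : ℝ) / 16 < ((M ^ i / 16 : ℕ) : ℝ) + 1 := by
          have := Nat.lt_div_mul_add (a := M ^ i) (b := 16) (by norm_num)
          have h'' : ((M ^ i : ℕ) : ℝ) < ((M ^ i / 16 : ℕ) : ℝ) * 16 + 16 := by exact_mod_cast this
          linarith
        linarith
      push_cast at hdiv ⊢
      linarith
    have hu0 : (0 : ℝ) ≤ ((M : ℝ) ^ i) / 16 := by positivity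
    have hcube : (((M : ℝ) ^ i) / 16) ^ 3 ≤ ((2 * (M ^ i / 16) + 1 : ℕ) : ℝ) ^ 3 :=
      pow_le_pow_left₀ hu0 hu 3
    have hMi : ((M : ℝ) ^ 3) ^ i = ((M : ℝ) ^ i) ^ 3 := by rw [← pow_mul, ← pow_mul, mul_comm]
    have hden : (0 : ℝ) < ((M : ℝ) ^ 3) ^ i := by positivity
    have hsm' : (i : ℝ) ^ p * 4096 ≤ c * A ^ p * ((M : ℝ) ^ i) ^ 3 := by
      rw [div_le_div_iff₀ hden (by norm_num)] at hsm
      rw [← hMi]; linarith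
    have hβp : c / β i ^ p = c * A ^ p / (i : ℝ) ^ p := by
      rw [hβi, div_pow]
      field_simp
    rw [hβp]
    have hip : (0 : ℝ) < (i : ℝ) ^ p := by positivity
    rw [mul_div_assoc', le_div_iff₀ hip, one_mul]
    calc (i : ℝ) ^ p ≤ (((M : ℝ) ^ i) / 16) ^ 3 * (c * A ^ p) := by
          have : (((M : ℝ) ^ i) / 16) ^ 3 * (c * A ^ p) = c * A ^ p * ((M : ℝ) ^ i) ^ 3 / 4096 := by ring
          rw [this, le_div_iff₀ (by norm_num : (0 : ℝ) < 4096)]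
          exact hsm'
      _ ≤ ((2 * (M ^ i / 16) + 1 : ℕ) : ℝ) ^ 3 * (c * A ^ p) :=
          mul_le_mul_of_nonneg_right hcube (by positivity)
  -- contradiction with the forced limit 0
  have hlt : ∀ᶠ i : ℕ in atTop, wilsonCentredSchwinger r.ρ (β i) ((M ^ i - 1) / 2) (fun _ => 1) 2
      (fun _ => r.curvature) (fun j => (blockDilate M)^[i] (facePair j)) < 1 :=
    hW'.eventually (gt_mem_nhds (by norm_num))
  obtain ⟨i, hi1, hi2⟩ := (hev.and hlt).exists
  linarith

/-- **The picked line's object dies with the crux under (H₁), (H₂).** `RegulatorChart G r M` (perfect-action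
regulator chart, field `corr_continuousOn` = the same ℝ⁴ⁿ-off-diagonal continuity clause) inhabits
`BalabanBanachStep G r M` by the landed bridge `nonempty_balabanBanachStep_of_regulatorChart`; hence it is empty at
every odd `M` under (H₁), (H₂). [folklore] -/
theorem not_nonempty_regulatorChart_of_faceContact (h₁ : PlaquetteCovNonneg r) (h₂ : AdjacentCovLowerBound r)
    (hM : Odd M) : ¬ Nonempty (RegulatorChart G r M) := fun ⟨𝒞⟩ =>
  not_nonempty_of_faceContact r h₁ h₂ hM (BalabanStepParabolic.nonempty_balabanBanachStep_of_regulatorChart 𝒞)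

end Contradiction

/-! ### The negative lemma for the crux: `SU(2)` with Wilson's fundamental action -/

section SU2

/-- Wilson's original model: the fundamental lattice representation of `SU(2)`. -/
def su2Fundamental : LatticeRep (Matrix.specialUnitaryGroup (Fin 2) ℂ) :=
  ⟨2, fundamentalRep (Fin 2), continuous_fundamentalRep _, fundamentalRep_injective _,
    fundamentalRep_mem_unitaryGroup⟩

/-- **The face-contact hypothesis `H`** (precise, NOT constructible in the tree today): for `SU(2)` lattice gauge
theory with Wilson's fundamental action on large odd tori at large `β`, (H₁) the covariances of the action
densities at any two sites are non-negative and (H₂) at nearest-neighbour sites they are `≥ c β^{-p}` for some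
`c > 0`, `p`.  (H₁) is a Griffiths-type inequality unknown for non-abelian gauge theories; (H₂) is the leading
perturbative behaviour (`p = 2`), unproved at weak coupling in four dimensions. -/
def FaceContactHypothesis : Prop :=
  letI : MeasurableSpace (Matrix.specialUnitaryGroup (Fin 2) ℂ) := borel _
  haveI : BorelSpace (Matrix.specialUnitaryGroup (Fin 2) ℂ) := ⟨rfl⟩
  PlaquetteCovNonneg su2Fundamental ∧ AdjacentCovLowerBound su2Fundamental

/-- **`¬ BalabanStepParabolic` modulo the face-contact hypothesis.** Under `H` the typed crux is false: for
`G = SU(2)` (a certified compact simple Lie group, `isSimpleCompactGroup_specialUnitaryGroup_holds`) and Wilson's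
fundamental action, `BalabanBanachStep G r M` is EMPTY for every odd `M` (`not_nonempty_of_faceContact`), so no
threshold `M₀` works.  Classification: refuted-misstated modulo `H` — repair (4c) by restricting to tuples supported
in the open fundamental cube (module docstring); the face-touching witness misses the repaired statement. [folklore] -/
theorem balabanStepParabolic_false_of_faceContactHypothesis (h : FaceContactHypothesis) :
    ¬ Summit.QuantumFields.YangMills.Theses.ParabolicTrajectory.BalabanStepParabolic := by
  intro hcrux
  letI : MeasurableSpace (Matrix.specialUnitaryGroup (Fin 2) ℂ) := borel _
  haveI : BorelSpace (Matrix.specialUnitaryGroup (Fin 2) ℂ) := ⟨rfl⟩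
  have hG : IsCompactSimpleLieGroup (Matrix.specialUnitaryGroup (Fin 2) ℂ) :=
    isCompactSimpleLieGroup_specialUnitaryGroup isSimpleCompactGroup_specialUnitaryGroup_holds le_rfl
  obtain ⟨M₀, hM₀⟩ := hcrux (Matrix.specialUnitaryGroup (Fin 2) ℂ) hG su2Fundamental
  exact not_nonempty_of_faceContact su2Fundamental h.1 h.2 ⟨M₀, rfl⟩ (hM₀ (2 * M₀ + 1) (by omega))

/-- **The line's odd-`M` stub is false modulo `H` as well**: `∀ G r, ∃ M₀, ∀ M ≥ M₀, Odd M → Nonempty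
(RegulatorChart G r M)` (hypothesis of the landed glue `balabanStepParabolic_of_regulatorChartOdd`) implies the
crux, hence fails under `FaceContactHypothesis`. [folklore] -/
theorem regulatorChartOdd_false_of_faceContactHypothesis (h : FaceContactHypothesis) :
    ¬ (∀ (G : Type) [Group G] [TopologicalSpace G] [IsTopologicalGroup G] [CompactSpace G],
      IsCompactSimpleLieGroup G →
      letI : MeasurableSpace G := borel G
      haveI : BorelSpace G := ⟨rfl⟩
      ∀ (r : LatticeRep G), ∃ M₀ : ℕ, ∀ M : ℕ, M₀ ≤ M → Odd M → Nonempty (RegulatorChart G r M)) :=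
  fun hline => balabanStepParabolic_false_of_faceContactHypothesis h
    (BalabanStepParabolic.balabanStepParabolic_of_regulatorChartOdd hline)

end SU2

end

end Summit.QuantumFields.YangMills.Theorems.BalabanStepParabolic.Negative
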